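import Summits.QuantumFields.YangMills.Theorems.UnitScaleTiltProp7SymAvgTwFrameDiff
import Summits.QuantumFields.YangMills.Theorems.UnitScaleTiltProp7AnalyticRemainderInputs
import Literature.MathematicalPhysics.QuantumFieldTheory.Balaban1983to89.B7Eq162General
import HarnessLib

/-!
# `UnitScaleTiltProp7SymAvgTwFrameBound` — THE SUP ROW OF THE LINEARISED FRAMES, `‖r y‖ ≤ 8∕R` (OWNER RULING g26-№1 Σ-TWIST (T), item (3c) «`‖rX‖ ≤ c_r·d·L^{K−n}‖X‖`»; the displayed row `hrb` of
# `Prop7SymAvgTwOfRegPr.exists_rightInv_QTw_of_regPr` DISCHARGED): at a printed-regular background, on the (44)∕(163)-window ball of radius `R` the accumulated comb frame `A ↦ frameTw U₀ A y` is analytic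
# and within `64dLᵏR ≤ 1∕32` of `1` ([Balaban1985Averaging] (163), lit-balaban `B7Eq162General.eq163_general`), so the Cauchy bound (★w4-20520 g2's `Prop7AnalyticRemainderInputs.norm_fderiv_le_of_bound`)
# gives `‖fderiv (A ↦ frameTw U₀ A y) 0‖ ≤ 8∕R` — `C_r = 8∕R ~ 16384·d·L^{K−n}` at print's natural radius
# (route `UnitScaleTilt`, crux K1 «MinimiserStabilityRegPr» stmt-QuantumFields-19200, stub `stub_existenceMinimalOrbit` (EX), route (α), (AVG-SYM); def-free, count-neutral)

Cell `ym3-torus` (HUMAN RULING D-0037, YM ladder rung R3 — YM₃ on T³ is a rung, not d = 4, not a mass gap, not Clay), width seat `ym-ust-20520-w5` (gen 3).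

THE PRINT.  [Balaban1985Averaging] p. 42 (161)–(163): «|v_k(x) − 1|, |v_k(x)⁻¹ − 1| ≤ …» (the accumulated frames of (97)∕(160) are close to `1` on the Prop.-4 window), Prop. 4 p. 38; [Balaban1985Variational]
(46) p. 285 (the sup-norm currency of the letter `H`).

WHAT IS PROVED (sorry-free, no definition; windows displayed at `(α₀, b) = (2ε₀, R)`: `C₀(d)·2ε₀ ≤ ⅓`, `4·2ε₀ ≤ c₂′`, `e^{c(d)·2ε₀}(1 + 8C₁L^{K−n}R) ≤ 2`, `2L^{K−n}R ≤ c₃`, `2048·d·L^{K−n}R ≤ 1`):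
* §1 ★**`analyticAt_frameTw_of_mem_ball`** — for `‖A₀‖ < R`: `AnalyticAt ℂ (A ↦ frameTw U₀ A y) A₀` ∧ `‖frameTw U₀ A₀ y − 1‖ ≤ 64·d·L^{K−n}R`.
* §2 ★★★**`norm_fderiv_frameTw_le_of_regPr`** — `‖fderiv ℂ (A ↦ frameTw U₀ A y) 0 A‖ ≤ (8∕R)·‖A‖` (= `hrb` with `C_r := 8∕R`).
HONEST FRAMING.  Plumbing over lit-balaban's kernel theorems, ✓p607923 and ★w4's Cauchy bound; the radius `R` is displayed; nothing of print is asserted.  `--supports stmt-QuantumFields-19200 --as helper`.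

References: T. Bałaban, CMP 98 (1985) 17–51 [Balaban1985Averaging] ((97) p.32, Prop. 4 p.38, (161)–(163) p.42); CMP 102 (1985) 277–309 [Balaban1985Variational] ((46) p.285); CMP 99 (1985) 75–102
[Balaban1985RegularSpaces] ((1.139) p.100).
-/

set_option autoImplicit false

noncomputable section

open scoped Matrix.Norms.L2Operator Topology

namespace Summit.QuantumFields.YangMills.Theorems.Prop7SymAvgTwFrameBound

open NormedSpace Metric Set Filter
open Literature.MathematicalPhysics.QuantumFieldTheory.Balaban1983to89
open Literature.MathematicalPhysics.QuantumFieldTheory.Balaban1983to89.T3ContinuumYM3Torus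
open T3PrintedRegularMinimiser (RegPr)
open T3SectALandauChart (bgUnits)
open B7Prop1Explicit renaming Site → LSite
open B7Prop1Explicit (expUnit)
open B7Prop2Explicit (pdev C0 c2' AvgClosed)
open B7Prop2SpecialUnitary (specialUnitaryUnits)
open B7Prop3Flat (expCfg c3)
open B7Eq92Concrete (vcov)
open B7Eq123General (dbavgCovIter_eq_expCfg_logCovIter)
open B7Eq162General (eq163_general)
open B7Prop6GeneralAnalytic (vcovQ vcov_eq_vcovQ analyticAt_vcovQ)
open B7AvgClosedSpecialUnitarySharp (avgClosed_specialUnitary_of_le_twentyone)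
open B10Eq27TorusAxialLog (pull transl)
open Summit.QuantumFields.YangMills.Theorems.Prop7SPrint (basePt)
open Summit.QuantumFields.YangMills.Theorems.Prop7AxialReprPrint (pull_toUField_mem inAk_pull_of_regPr pdev_pull_lt)
open Summit.QuantumFields.YangMills.Theorems.Prop7SymAvgGLSmallOfRegPr (bgUnits_eq)
open Summit.QuantumFields.YangMills.Theorems.Prop7SymAvgTw (coordT3 frameTw)
open Summit.QuantumFields.YangMills.Theorems.Prop7SymAvgTwFrameDiff (frameTw_eq_vcov norm_pullExp_le)
open Summit.QuantumFields.YangMills.Theorems.Prop7AnalyticRemainderInputs (norm_fderiv_le_of_bound)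

variable (F : T3Family) {n K : ℕ} (h : n ≤ K)

/-! ## §1 On the whole (44)-ball of radius `R`: the frame is `vcovQ`, analytic, and within `1∕32` of `1` -/

/-- **ON THE BALL `‖A‖ < R` INSIDE THE (44)-WINDOW AT `b := R`, THE FRAME IS ANALYTIC AND CLOSE TO `1`**: for `RegPr F n K ε₀ U₀` and the Prop.-4∕Prop.-6 windows at `(α₀, b) = (2ε₀, R)` —
`C₀(d)·2ε₀ ≤ ⅓`, `4·2ε₀ ≤ c₂′`, `e^{c(d)·2ε₀}(1 + 8C₁LᵏR) ≤ 2`, `2LᵏR ≤ c₃`, `2048·d·LᵏR ≤ 1` — every `A₀` with `‖A₀‖ < R` has `A ↦ frameTw U₀ A y` analytic at `A₀` (lit-balaban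
`analyticAt_vcovQ` at `t₀ = A₀`, `vcov = vcovQ` on the ball) and `‖frameTw U₀ A₀ y − 1‖ ≤ 64·d·LᵏR` ([Balaban1985Averaging] (163), `B7Eq162General.eq163_general`).
[cite: Balaban1985Averaging, Prop. 4 p.38, (163) p.42, (97) p.32; Balaban1985RegularSpaces, (1.139) p.100] -/
theorem analyticAt_frameTw_of_mem_ball {ε₀ R : ℝ} (hε₀ : 0 < ε₀) (hR : 0 < R)
    (hα3 : C0 (F.P K).d * (2 * ε₀) ≤ 1 / 3) (hα4 : 4 * (2 * ε₀) ≤ c2' (F.P K).d (F.P K).L)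
    (hsmall : Real.exp (4 * (800 * (((F.P K).d : ℝ) + 1) ^ 2 * (((F.P K).d : ℝ) + 4)) * (2 * ε₀))
      * (1 + 8 * (131072 * (((F.P K).d : ℝ) + 1) ^ 2) * (((F.P K).L : ℝ) ^ (K - n) * R)) ≤ 2)
    (hc₃ : 2 * (((F.P K).L : ℝ) ^ (K - n) * R) ≤ c3 (F.P K).d (F.P K).L) (hsm : 2048 * ((F.P K).d : ℝ) * (((F.P K).L : ℝ) ^ (K - n) * R) ≤ 1)
    (U₀ : GaugeField (F.P K) 0 (Matrix.specialUnitaryGroup (Fin 2) ℂ)) (hreg : RegPr F n K ε₀ U₀) (y : Site (F.P n) 0)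
    {A₀ : PBond (F.P K) 0 → Matrix (Fin 2) (Fin 2) ℂ} (hA₀ : ‖A₀‖ < R) :
    AnalyticAt ℂ (fun A : PBond (F.P K) 0 → Matrix (Fin 2) (Fin 2) ℂ => ((frameTw F n K h U₀ A y : (Matrix (Fin 2) (Fin 2) ℂ)ˣ) : Matrix (Fin 2) (Fin 2) ℂ)) A₀ ∧
      ‖((frameTw F n K h U₀ A₀ y : (Matrix (Fin 2) (Fin 2) ℂ)ˣ) : Matrix (Fin 2) (Fin 2) ℂ) - 1‖ ≤ 64 * ((F.P K).d : ℝ) * (((F.P K).L : ℝ) ^ (K - n) * R) := by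
  have hL2 : 2 ≤ (F.P K).L := (F.P K).hL.2
  have hd : (F.P K).d = 3 := T3Family.P_d F K
  have hU₀ : ∀ z κ, pull (bgUnits F K U₀) (basePt F n K) z κ ∈ specialUnitaryUnits (Fin 2) := fun z κ => by
    rw [bgUnits_eq]; exact pull_toUField_mem U₀ _ z κ
  have hG := avgClosed_specialUnitary_of_le_twentyone (N := 2) (by norm_num) (F.P K).d (F.P K).L
  have h52 : pdev (pull (bgUnits F K U₀) (basePt F n K)) < 2 * ε₀ * ((((F.P K).L : ℝ) ^ (K - n))⁻¹) ^ 2 := by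
    rw [bgUnits_eq]; exact pdev_pull_lt (P := F.P K) hε₀ (inAk_pull_of_regPr F (n := n) (K := K) hε₀.le hreg) (basePt F n K)
  have hα : 0 < 2 * ε₀ := by positivity
  set B : (PBond (F.P K) 0 → Matrix (Fin 2) (Fin 2) ℂ) → LSite (F.P K).d → Fin (F.P K).d → Matrix (Fin 2) (Fin 2) ℂ :=
    fun A z κ => A ⟨transl (basePt F n K) z, κ⟩ with hB
  have hBa : ∀ z κ, AnalyticAt ℂ (fun A : PBond (F.P K) 0 → Matrix (Fin 2) (Fin 2) ℂ => B A z κ) A₀ := fun z κ =>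
    (ContinuousLinearMap.proj (R := ℂ) (φ := fun _ : PBond (F.P K) 0 => Matrix (Fin 2) (Fin 2) ℂ) (⟨transl (basePt F n K) z, κ⟩ : PBond (F.P K) 0)).analyticAt A₀
  -- the window at `b = R` dominates every `A` in the ball
  have hwin : ∀ A : PBond (F.P K) 0 → Matrix (Fin 2) (Fin 2) ℂ, ‖A‖ < R →
      (∀ z κ, ‖B A z κ‖ ≤ R) ∧
      ∀ j ≤ K - n, B7Eq92Concrete.dbavgCovIter (F.P K).L (pull (bgUnits F K U₀) (basePt F n K)) (expCfg (B A)) j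
        = expCfg (B7Prop4GeneralLevels.logCovIter (F.P K).L (pull (bgUnits F K U₀) (basePt F n K)) (B A) j) := by
    intro A hA
    have hBA : ∀ z κ, ‖B A z κ‖ ≤ R := fun z κ => (norm_pullExp_le F A (basePt F n K) z κ).trans hA.le
    exact ⟨hBA, dbavgCovIter_eq_expCfg_logCovIter (F.P K).L hL2 hG (K - n) (pull (bgUnits F K U₀) (basePt F n K)) hU₀ hα hα3 hα4 h52 (B A)
      hR.le hBA hsmall hc₃⟩
  have κ₀ : Fin (F.P K).d := Fin.cast hd.symm 0
  have hvQ := (analyticAt_vcovQ (E := PBond (F.P K) 0 → Matrix (Fin 2) (Fin 2) ℂ) (F.P K).L hL2 hG (K - n) (pull (bgUnits F K U₀) (basePt F n K)) hU₀ hα hα3 hα4 h52 B hBa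
    hR.le (hwin A₀ hA₀).1 hsmall hc₃ κ₀ (K - n) le_rfl (coordT3 F n K h y)).1
  have hev : (fun A : PBond (F.P K) 0 → Matrix (Fin 2) (Fin 2) ℂ =>
        ((vcovQ (F.P K).L (pull (bgUnits F K U₀) (basePt F n K)) (B A) (K - n) (coordT3 F n K h y) : (Matrix (Fin 2) (Fin 2) ℂ)ˣ) : Matrix (Fin 2) (Fin 2) ℂ))
      =ᶠ[𝓝 A₀] fun A => ((frameTw F n K h U₀ A y : (Matrix (Fin 2) (Fin 2) ℂ)ˣ) : Matrix (Fin 2) (Fin 2) ℂ) := by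
    have hopen : Metric.ball (0 : PBond (F.P K) 0 → Matrix (Fin 2) (Fin 2) ℂ) R ∈ 𝓝 A₀ := isOpen_ball.mem_nhds (mem_ball_zero_iff.2 hA₀)
    filter_upwards [hopen] with A hA
    rw [frameTw_eq_vcov, vcov_eq_vcovQ (F.P K).L _ (B A) (K - n) (hwin A (mem_ball_zero_iff.1 hA)).2 (K - n) le_rfl]
  refine ⟨hvQ.congr hev, ?_⟩
  -- (163) at `A₀`
  obtain ⟨⟨h1, -⟩, h64⟩ := eq163_general hL2 hG hU₀ hα hα3 hα4 h52 hR.le (hwin A₀ hA₀).1 hsmall hc₃ hsm (le_refl (K - n)) (coordT3 F n K h y)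
  rw [frameTw_eq_vcov]
  exact h1.trans h64

/-! ## §2 ★ The sup row of the linearised frames: `‖r y‖ ≤ 8∕R` -/

/-- ★★★ **THE ROW `‖r y A‖ ≤ C_r‖A‖` OF `Prop7SymAvgTwOfRegPr.exists_rightInv_QTw_of_regPr`, DISCHARGED with `C_r := 8∕R`**: at a printed-regular background with the (44)∕(163)-window of radius `R`
(§1's five numeric hypotheses), the linearised accumulated frame `r y = fderiv (A ↦ frameTw U₀ A y) 0` has operator norm `≤ 8∕R` — the Cauchy bound `‖Df(0)‖ ≤ 4M∕R` (★w4-20520 g2's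
`Prop7AnalyticRemainderInputs.norm_fderiv_le_of_bound`) for the analytic, `M = 2`-bounded map `A ↦ frameTw U₀ A y` on `ball 0 R` (`‖v − 1‖ ≤ 64dLᵏR ≤ 1∕32`).  With print's natural
`R ~ 1∕(2048·d·Lᵏ)` this is `C_r ~ 16384·d·L^{K−n}` (RULING g26-№1 (3c) «C_r ≲ d·L^{K−n}», the (−1)-weight). [cite: Balaban1985Averaging, (161)–(163) p.42, Prop. 4 p.38; Balaban1985Variational, (46) p.285] -/
theorem norm_fderiv_frameTw_le_of_regPr {ε₀ R : ℝ} (hε₀ : 0 < ε₀) (hR : 0 < R)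
    (hα3 : C0 (F.P K).d * (2 * ε₀) ≤ 1 / 3) (hα4 : 4 * (2 * ε₀) ≤ c2' (F.P K).d (F.P K).L)
    (hsmall : Real.exp (4 * (800 * (((F.P K).d : ℝ) + 1) ^ 2 * (((F.P K).d : ℝ) + 4)) * (2 * ε₀))
      * (1 + 8 * (131072 * (((F.P K).d : ℝ) + 1) ^ 2) * (((F.P K).L : ℝ) ^ (K - n) * R)) ≤ 2)
    (hc₃ : 2 * (((F.P K).L : ℝ) ^ (K - n) * R) ≤ c3 (F.P K).d (F.P K).L) (hsm : 2048 * ((F.P K).d : ℝ) * (((F.P K).L : ℝ) ^ (K - n) * R) ≤ 1)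
    (U₀ : GaugeField (F.P K) 0 (Matrix.specialUnitaryGroup (Fin 2) ℂ)) (hreg : RegPr F n K ε₀ U₀) (y : Site (F.P n) 0)
    (A : PBond (F.P K) 0 → Matrix (Fin 2) (Fin 2) ℂ) :
    ‖fderiv ℂ (fun A : PBond (F.P K) 0 → Matrix (Fin 2) (Fin 2) ℂ => ((frameTw F n K h U₀ A y : (Matrix (Fin 2) (Fin 2) ℂ)ˣ) : Matrix (Fin 2) (Fin 2) ℂ)) 0 A‖
      ≤ 8 / R * ‖A‖ := by
  have hd : (F.P K).d = 3 := T3Family.P_d F K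
  -- differentiable and bounded by 2 on the ball
  have hdiff : DifferentiableOn ℂ (fun A : PBond (F.P K) 0 → Matrix (Fin 2) (Fin 2) ℂ =>
      ((frameTw F n K h U₀ A y : (Matrix (Fin 2) (Fin 2) ℂ)ˣ) : Matrix (Fin 2) (Fin 2) ℂ)) (ball (0 : PBond (F.P K) 0 → Matrix (Fin 2) (Fin 2) ℂ) R) :=
    fun A₀ hA₀ => (analyticAt_frameTw_of_mem_ball F h hε₀ hR hα3 hα4 hsmall hc₃ hsm U₀ hreg y (mem_ball_zero_iff.1 hA₀)).1.differentiableAt.differentiableWithinAt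
  have hbd : ∀ A₀ ∈ ball (0 : PBond (F.P K) 0 → Matrix (Fin 2) (Fin 2) ℂ) R,
      ‖((frameTw F n K h U₀ A₀ y : (Matrix (Fin 2) (Fin 2) ℂ)ˣ) : Matrix (Fin 2) (Fin 2) ℂ)‖ ≤ 2 := by
    intro A₀ hA₀
    have h64 := (analyticAt_frameTw_of_mem_ball F h hε₀ hR hα3 hα4 hsmall hc₃ hsm U₀ hreg y (mem_ball_zero_iff.1 hA₀)).2
    have h32 : 64 * ((F.P K).d : ℝ) * (((F.P K).L : ℝ) ^ (K - n) * R) ≤ 1 := by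
      have : 64 * ((F.P K).d : ℝ) * (((F.P K).L : ℝ) ^ (K - n) * R) ≤ 2048 * ((F.P K).d : ℝ) * (((F.P K).L : ℝ) ^ (K - n) * R) := by
        have hx : 0 ≤ ((F.P K).d : ℝ) * (((F.P K).L : ℝ) ^ (K - n) * R) := by positivity
        nlinarith
      exact this.trans hsm
    calc ‖((frameTw F n K h U₀ A₀ y : (Matrix (Fin 2) (Fin 2) ℂ)ˣ) : Matrix (Fin 2) (Fin 2) ℂ)‖
        = ‖(((frameTw F n K h U₀ A₀ y : (Matrix (Fin 2) (Fin 2) ℂ)ˣ) : Matrix (Fin 2) (Fin 2) ℂ) - 1) + 1‖ := by rw [sub_add_cancel]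
      _ ≤ ‖((frameTw F n K h U₀ A₀ y : (Matrix (Fin 2) (Fin 2) ℂ)ˣ) : Matrix (Fin 2) (Fin 2) ℂ) - 1‖ + ‖(1 : Matrix (Fin 2) (Fin 2) ℂ)‖ := norm_add_le _ _
      _ ≤ 1 + 1 := add_le_add (h64.trans h32) (by rw [norm_one])
      _ = 2 := by norm_num
  have hC := norm_fderiv_le_of_bound (Y := (0 : PBond (F.P K) 0 → Matrix (Fin 2) (Fin 2) ℂ)) hR hdiff hbd (by rw [norm_zero]; positivity)
  calc ‖fderiv ℂ (fun A : PBond (F.P K) 0 → Matrix (Fin 2) (Fin 2) ℂ => ((frameTw F n K h U₀ A y : (Matrix (Fin 2) (Fin 2) ℂ)ˣ) : Matrix (Fin 2) (Fin 2) ℂ)) 0 A‖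
      ≤ ‖fderiv ℂ (fun A : PBond (F.P K) 0 → Matrix (Fin 2) (Fin 2) ℂ => ((frameTw F n K h U₀ A y : (Matrix (Fin 2) (Fin 2) ℂ)ˣ) : Matrix (Fin 2) (Fin 2) ℂ)) 0‖ * ‖A‖ :=
        ContinuousLinearMap.le_opNorm _ _
    _ ≤ 4 * 2 / R * ‖A‖ := mul_le_mul_of_nonneg_right hC (norm_nonneg _)
    _ = 8 / R * ‖A‖ := by norm_num

end Summit.QuantumFields.YangMills.Theorems.Prop7SymAvgTwFrameBound

end
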